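import Literature.NumberTheory.GaloisRepresentations.LocalUnitNorms
import Literature.NumberTheory.GaloisRepresentations.UnitsHerbrand
import Literature.NumberTheory.GaloisRepresentations.ArtinCharacterReciprocityProofs
import HarnessLib

/-!
# Hasse's norm theorem for cyclic extensions of number fields (idelic form), in every universe

Topic `NumberTheory/GaloisRepresentations` (global class field theory); namespace
`Literature.NumberTheory.GaloisRepresentations.IdeleHerbrand`.  Proof file: theorems only (no
definition, no named fact, no instance; D-0026).

For a finite **cyclic** extension of number fields `E/F` with group `G = ⟨σ⟩`, Tate
(Cassels–Fröhlich, Ch. VII §9, Thm. 9.1 and its Corollary; §9.6) proves `H¹(G, C_E) = 0` and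
deduces **Hasse's norm theorem** (Hasse 1931; op. cit. Ch. VII §9.6, "an element of `K` is a norm
from `L` if and only if it is a local norm everywhere", for `L/K` cyclic): from the exact sequence
`0 → Lˣ → J_L → C_L → 0` and `H¹(G, C_L) = Ĥ⁻¹(G, C_L) = 0`, the map
`Ĥ⁰(G, Lˣ) = Kˣ/N Lˣ → Ĥ⁰(G, J_L) = J_K / N J_L` is injective, i.e. `Kˣ ∩ N_{L/K} J_L = N_{L/K} Lˣ`.

The tree proves `H¹(G, C_E) = 0` in element form
(`Automorphic/ArthurClozelCuspidalDescentGLOneClassField.lean`: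
`exists_eq_mul_smul_div_of_ideleGalNorm_mem_principalIdeles`) and the norm index equality
`[𝕀_F : Fˣ N 𝕀_E] = [E : F]` (`Automorphic/ExistsClassFieldCharacterHolds.lean`), but only for
`F E : Type`; the consumer here (`Literature.NumberTheory.EllipticCurves.Cassels1962_index_eq_period_of_mem_sha`,
through the Hasse principle for `H²(K, K̄ˣ)`) quantifies over `K : Type u`.  This file re-assembles
the same proofs in an arbitrary universe from the tree's universe-polymorphic inputs (Artin's kernel
crossing `ArtinKernelCrossing`, the idèle/ideal dictionary `ArtinCharacterReciprocityProofs`, the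
idelic first inequality `UnitsHerbrand` / `IdeleClassHerbrand` / `GlobalNormIndexIdelic`, the local
triviality of unit cohomology `LocalUnitNorms`), exactly as `IdelicLocalNorm.lean` redid
`ClassFieldCharacterLocal.lean`:

* `IdeleHerbrand.index_normGroup_eq_finrank` — `[𝕀_F : Fˣ N_{E/F} 𝕀_E] = [E : F]` (Tate §5.1 (B) at
  the level of indices; upper bound by kernel crossing, lower bound = first inequality);
* `IdeleHerbrand.h1_top_principalIdeles_eq_one` — `#Ĥ⁻¹(G; J_E, Eˣ) = 1`, i.e. `H¹(G, C_E) = 0`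
  (Tate Thm. 9.1 (2), Step 2 of its proof: `#Ĥ⁰ = [E:F] · #Ĥ⁻¹` and `#Ĥ⁰ = [𝕀_F : Fˣ N 𝕀_E]`);
* `IdeleHerbrand.exists_eq_principal_mul_twist_of_ideleGalNorm_mem` — element form: an idele of `E`
  whose Galois norm is principal is `(k) · (σ z / z)`;
* `IdeleHerbrand.hasseNorm_of_ideleGalNorm_eq_principal` — **Hasse's norm theorem (idelic form)**:
  if `a ∈ Fˣ` is the Galois norm `∏_σ σ • y` of an idele `y` of `E` (that is, `a` is a local norm
  everywhere), then `a = N_{E/F}(k)` for some `k ∈ Eˣ`.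

## References

* J. W. S. Cassels, A. Fröhlich (eds.), *Algebraic Number Theory* (1967), Ch. VII (J. Tate,
  *Global class field theory*), §5.1 Main Theorem (B), §9 Thm. 9.1 and Cor., §9.6 (Hasse norm
  theorem), §11.4. [CasselsFrohlichANT1967]
* H. Hasse, *Beweis eines Satzes und Widerlegung einer Vermutung über das allgemeine Normenrestsymbol*,
  Nachr. Ges. Wiss. Göttingen (1931), 64–69 (the norm theorem for cyclic extensions).
* N. Childress, *Class Field Theory*, Universitext (2009), Ch. 4 §5 Thm. 5.11–5.12, Ch. 5 §2
  Prop. 2.2. [Childress2009]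
-/

noncomputable section

open NumberField IsDedekindDomain
open scoped nonZeroDivisors

namespace Literature.NumberTheory.GaloisRepresentations

namespace IdeleHerbrand

open Literature.NumberTheory.Automorphic

universe u

variable {F : Type u} [Field F] [NumberField F] {E : Type u} [Field E] [NumberField E] [Algebra F E]

/-- **The idelic norm index equality `[𝕀_F : Fˣ N_{E/F} 𝕀_E] = [E : F]` for a cyclic extension of
number fields, in every universe** (Tate's Main Theorem (B), Cassels–Fröhlich Ch. VII §5.1, at the
level of indices).  Upper bound: on the congruence idèles `W = W_𝔪` for the admissible modulus `𝔪`,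
the Artin character `ψ = χ₀ ∘ Frob ∘ (w ↦ (w))` of a faithful character `χ₀` of `Gal(E/F)` has
`ker ψ ≤ N ∩ W` by Artin's kernel crossing (Childress Ch. 5 Prop. 2.2) and the idèle/ideal
dictionary, so `[𝕀_F : N] = [W : N ∩ W] ∣ [W : ker ψ] = #ψ(W) ≤ #Gal(E/F)`; lower bound: the idelic
first inequality `[E:F] ∣ [𝕀_F : N] ≠ 0` (Childress Thm. 5.12).  Same proof as the tree's
`Automorphic.index_normGroup_eq_finrank_of_isCyclic` (stated there for `Type` only).
[cite: CasselsFrohlichANT1967, Ch. VII §5.1 Main Theorem (B)] -/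
theorem index_normGroup_eq_finrank [IsGalois F E] [IsCyclic (E ≃ₐ[F] E)] :
    (normGroup F E).index = Module.finrank F E := by
  classical
  obtain ⟨σ, hσ⟩ := IsCyclic.exists_generator (α := E ≃ₐ[F] E)
  set 𝔪 : Ideal (𝓞 F) := IdeleHerbrand.admissibleModulus F E with h𝔪def
  have h𝔪 : 𝔪 ≠ ⊥ := IdeleHerbrand.admissibleModulus_ne_bot F E
  have hram : ∀ v : HeightOneSpectrum (𝓞 F), ¬ 𝔪 ≤ v.asIdeal →
      Algebra.IsUnramifiedIn (𝓞 E) v.asIdeal :=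
    fun v hv => not_not.mp fun h => hv ((IdeleHerbrand.admissibleModulus_le_iff (E := E) v).mpr h)
  set W : Subgroup (ideleGroup F) := congruenceIdeles 𝔪 with hWdef
  -- a faithful character of the Galois group and its Artin homomorphism on `W`
  obtain ⟨χ₀, hχ₀⟩ := exists_monoidHom_units_complex_injective (E ≃ₐ[F] E)
  set 𝒜 : (FractionalIdeal (𝓞 F)⁰ F)ˣ →* ℂˣ := artinHom fun v => χ₀ (galFrob F E v) with h𝒜def
  set ΦW : W →* (FractionalIdeal (𝓞 F)⁰ F)ˣ := (IdeleHerbrand.idealOfIdele F).comp W.subtype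
    with hΦWdef
  set ψ : W →* ℂˣ := 𝒜.comp ΦW with hψdef
  have hψ_apply : ∀ w : W, ψ w = 𝒜 (IdeleHerbrand.idealOfIdele F (w : ideleGroup F)) := fun w => rfl
  -- (1) `ker ψ ≤ N ∩ W` (Artin's kernel crossing + the idèle/ideal dictionary)
  have hker : ψ.ker ≤ (normGroup F E).subgroupOf W := by
    rintro ⟨w, hw⟩ hwk
    rw [MonoidHom.mem_ker, hψ_apply] at hwk
    rw [Subgroup.mem_subgroupOf]
    have hI : IdeleHerbrand.idealOfIdele F w ∈ idealsPrimeTo 𝔪 :=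
      IdeleHerbrand.idealOfIdele_mem_idealsPrimeTo h𝔪 hw
    have hAk : IdeleHerbrand.idealOfIdele F w ∈ 𝒜.ker ⊓ idealsPrimeTo 𝔪 :=
      Subgroup.mem_inf.mpr ⟨MonoidHom.mem_ker.mpr hwk, hI⟩
    exact IdeleHerbrand.mem_normGroup_of_idealOfIdele_mem hσ hw
      (ker_artinHom_inf_idealsPrimeTo_le_ray_sup_normSubgroup hχ₀ h𝔪 hram hAk)
  -- (2) `[W : ker ψ] = #ψ(W) ≤ #Gal(E/F) = n`, and it is finite (nonzero)
  have hrange : ψ.range ≤ χ₀.range := by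
    rintro _ ⟨w, rfl⟩
    rw [hψ_apply]
    exact artinHom_mem_of_forall_mem (fun v => MonoidHom.mem_range.mpr ⟨galFrob F E v, rfl⟩) _
  haveI : Finite χ₀.range := Set.finite_range χ₀ |>.to_subtype
  have hcardG : Nat.card (E ≃ₐ[F] E) = Module.finrank F E := IsGalois.card_aut_eq_finrank F E
  have hψidx : ψ.ker.index = Nat.card ψ.range := Subgroup.index_ker ψ
  have hψle : ψ.ker.index ≤ Module.finrank F E := by
    rw [hψidx, ← hcardG]
    calc Nat.card ψ.range ≤ Nat.card χ₀.range := Nat.card_mono (Set.toFinite _) hrange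
      _ ≤ Nat.card (E ≃ₐ[F] E) :=
        Nat.card_le_card_of_surjective _ (MonoidHom.rangeRestrict_surjective χ₀)
  have hψne : ψ.ker.index ≠ 0 := by
    rw [hψidx]
    haveI : Finite ψ.range := Finite.Set.subset (χ₀.range : Set ℂˣ) hrange
    exact Nat.card_pos.ne'
  -- (3) `[𝕀_F : N] = n`: `[𝕀_F : N] = [W : N ∩ W] ∣ [W : ker ψ] ≤ n` and `n ∣ [𝕀_F : N] ≠ 0`
  have hNW : (normGroup F E).index = ((normGroup F E).subgroupOf W).index := by
    rw [IdeleHerbrand.index_normGroup_eq_relIndex (F := F) (E := E), Subgroup.relIndex,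
      Subgroup.inf_subgroupOf_right]
  have hNle : (normGroup F E).index ≤ Module.finrank F E := by
    rw [hNW]
    exact (Nat.le_of_dvd (Nat.pos_of_ne_zero hψne) (Subgroup.index_dvd_of_le hker)).trans hψle
  obtain ⟨hndvd, hN0⟩ := IdeleHerbrand.card_dvd_index_normGroup_of_isCyclic (F := F) (E := E) hσ
  rw [← Nat.card_eq_fintype_card, hcardG] at hndvd
  exact le_antisymm hNle (Nat.le_of_dvd (Nat.pos_of_ne_zero hN0) hndvd)

/-- **`H¹(Gal(E/F), C_E) = 0` for a cyclic extension of number fields, in every universe**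
(`Gal(E/F) = ⟨σ⟩`): `#Ĥ⁻¹(G; J_E, Eˣ) = 1`.  Step 2 of Tate's proof of Cassels–Fröhlich Ch. VII
Thm. 9.1: `#Ĥ⁰(G; J_E, Eˣ) = [𝕀_F : Fˣ N 𝕀_E]` (`h0_top_principalIdeles_eq_index_normGroup`)
`= [E : F]` (`index_normGroup_eq_finrank`) `= [E : F] · #Ĥ⁻¹(G; J_E, Eˣ)`
(`IdeleHerbrand.h0_top_principalIdeles_eq`, Childress Thm. 5.11, with its inputs
`SemiLocal.exists_finset_local_triviality` and `IdeleHerbrand.card_mul_h0_globalUnits_eq`).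
[cite: CasselsFrohlichANT1967, Ch. VII §9 Thm. 9.1 (2)] -/
theorem h1_top_principalIdeles_eq_one [IsGalois F E] {σ : E ≃ₐ[F] E}
    (hσ : ∀ τ : E ≃ₐ[F] E, τ ∈ Subgroup.zpowers σ) :
    Herbrand.h1 σ ⊤ (principalIdeles E) = 1 := by
  haveI : IsCyclic (E ≃ₐ[F] E) := ⟨⟨σ, hσ⟩⟩
  obtain ⟨S, hun₀, hun₁⟩ := SemiLocal.exists_finset_local_triviality (F := F) (E := E) hσ
  obtain ⟨hunits, hunits'⟩ := IdeleHerbrand.card_mul_h0_globalUnits_eq (F := F) (E := E) hσ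
  obtain ⟨h0, -⟩ := IdeleHerbrand.h0_top_principalIdeles_eq hσ S hun₀ hun₁ hunits hunits'
  rw [h0_top_principalIdeles_eq_index_normGroup hσ, index_normGroup_eq_finrank (F := F) (E := E),
    ← IsGalois.card_aut_eq_finrank, ← Fintype.card_eq_nat_card] at h0
  have hpos : 0 < Fintype.card (E ≃ₐ[F] E) := Fintype.card_pos
  refine Nat.eq_of_mul_eq_mul_left hpos ?_
  rw [mul_one]
  exact h0.symm

/-- **Hilbert 90 for idele classes of a cyclic extension (element form, every universe)**: for
`E/F` cyclic with `Gal(E/F) = ⟨σ⟩`, an idele `y` of `E` whose Galois norm `∏_g g • y` is principal is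
`(k) · (σ z / z)` with `k ∈ Eˣ`. [cite: CasselsFrohlichANT1967, Ch. VII §9 Thm. 9.1 (2)] -/
theorem exists_eq_principal_mul_twist_of_ideleGalNorm_mem [IsGalois F E] {σ : E ≃ₐ[F] E}
    (hσ : ∀ τ : E ≃ₐ[F] E, τ ∈ Subgroup.zpowers σ) {y : ideleGroup E}
    (hy : AdeleRing.ideleGalNorm F E y ∈ principalIdeles E) :
    ∃ k : Eˣ, ∃ z : ideleGroup E, y = principal E k * (σ • z / z) := by
  haveI : FiniteDimensional F E := inferInstance
  have hmem : y ∈ Herbrand.b1 σ ⊤ (principalIdeles E) :=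
    Herbrand.h1_eq_one_iff.1 (h1_top_principalIdeles_eq_one hσ) y (Subgroup.mem_top y)
      (by rwa [norm_eq_ideleGalNorm])
  obtain ⟨p, ⟨k, rfl⟩, z, -, rfl⟩ := Herbrand.mem_b1.1 hmem
  exact ⟨k, z, by rw [Herbrand.twist_apply]; rfl⟩

/-- **Hasse's norm theorem for cyclic extensions of number fields (idelic form, every universe).**
For `E/F` cyclic and `a ∈ Fˣ`: if the principal idele of `a` (in `𝕀_E`) is the Galois norm
`∏_{g ∈ Gal(E/F)} g • y` of some idele `y` of `E` — i.e. `a` is a local norm from `E` at every place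
of `F` — then `a` is a global norm: `a = N_{E/F}(k)` for some `k ∈ Eˣ`.  (Tate: `H¹(G, C_E) = 0`
gives `y = (k)(σz/z)`, and `N(σ z / z) = 1`.)
[cite: CasselsFrohlichANT1967, Ch. VII §9.6 (Hasse norm theorem) with Thm. 9.1] -/
theorem hasseNorm_of_ideleGalNorm_eq_principal [IsGalois F E] [IsCyclic (E ≃ₐ[F] E)] (a : Fˣ)
    (y : ideleGroup E)
    (hy : AdeleRing.ideleGalNorm F E y = principal E (CyclicNormIndex.unitsIncl F E a)) :
    ∃ k : Eˣ, Algebra.norm F (k : E) = a := by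
  obtain ⟨σ, hσ⟩ := IsCyclic.exists_generator (α := E ≃ₐ[F] E)
  have hmem : AdeleRing.ideleGalNorm F E y ∈ principalIdeles E := by
    rw [hy]; exact ⟨_, rfl⟩
  obtain ⟨k, z, rfl⟩ := exists_eq_principal_mul_twist_of_ideleGalNorm_mem hσ hmem
  refine ⟨k, ?_⟩
  -- `N y = N (k) = (N_{E/F} k)`
  have hN : AdeleRing.ideleGalNorm F E (principal E k * (σ • z / z)) =
      principal E (CyclicNormIndex.normEnd σ (Nat.card (E ≃ₐ[F] E)) k) := by
    rw [map_mul, map_div, AdeleRing.ideleGalNorm_smul, div_self', mul_one,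
      ← norm_eq_ideleGalNorm, ← Herbrand.map_norm_eq (principal E) (fun g y => principal_smul g y) k,
      norm_units_eq_normEnd hσ]
  rw [hN] at hy
  have hk : CyclicNormIndex.normEnd σ (Nat.card (E ≃ₐ[F] E)) k = CyclicNormIndex.unitsIncl F E a :=
    principal_injective hy
  have hk' := congrArg (fun u : Eˣ => (u : E)) hk
  simp only [CyclicNormIndex.coe_normEnd_eq_algebraMap_norm hσ] at hk'
  exact (algebraMap F E).injective hk'

end IdeleHerbrand

end Literature.NumberTheory.GaloisRepresentations
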